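import Mathlib
import HarnessLib

/-!
# The transverse pinch — box integrals and light-cone chart lemmas (crux `PencilRigidity.ShellRigidity`,
line `thales-slit-exact-cone-type`, stmt-QuantumFields-11685; helpers of the registered stub
`stub_transversePinch`, part 2 of 2)

Elementary facts used by the second line lead's back end ("transverse pinch"):

* iterated box integrals of jointly continuous functions are additive (`iter_add`, `iter_sub`);
* for a finite positive measure on momentum space carried by the light cone `{p₀ ≥ |p₁|}`, the chart
  weights `e^{-(A p₀ + B p₁)}`, `|B| < A`, are `≤ 1` a.e. and monotone in `A - |B|`
  (`ae_weight_mono`), the chart integrands are integrable (`integrable_chart`), and the TWO-POINT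
  positivity `P(0) ± P(ζ) = ∫ e^{-(A p₀ + B p₁)} (1 ± cos(ζ·p_⊥)) dμ ≥ 0` holds (`two_point`).

All folklore; no definitions, no named facts.
-/

noncomputable section

namespace Summit.QuantumFields.YangMills.Cruxes.ShellRigidity.ThalesSlitExactConeType

open MeasureTheory Complex Real Filter Topology
open scoped InnerProductSpace BigOperators

local notation "E4" => EuclideanSpace ℝ (Fin 4)

namespace TransversePinch

/-! ## Iterated box integrals of jointly continuous functions -/

/-- The box `[0,δ]²` is compact. -/
theorem isCompact_box (δ : ℝ) : IsCompact (Set.Icc (0 : ℝ) δ ×ˢ Set.Icc (0 : ℝ) δ) :=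
  isCompact_Icc.prod isCompact_Icc

/-- Inner integrability of a jointly continuous function on the box. -/
theorem integrableOn_inner {f : ℝ × ℝ → ℝ × ℝ → ℝ} (hf : Continuous (Function.uncurry f)) (δ : ℝ)
    (w : ℝ × ℝ) : IntegrableOn (fun w' => f w w') (Set.Icc (0 : ℝ) δ ×ˢ Set.Icc (0 : ℝ) δ) :=
  (hf.comp (continuous_const.prodMk continuous_id) :
    Continuous fun w' => Function.uncurry f (w, w')).continuousOn.integrableOn_compact (isCompact_box δ)

/-- The inner box integral of a jointly continuous function is continuous in the outer variable. -/
theorem continuous_inner {f : ℝ × ℝ → ℝ × ℝ → ℝ} (hf : Continuous (Function.uncurry f)) (δ : ℝ) :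
    Continuous fun w => ∫ w' in Set.Icc (0 : ℝ) δ ×ˢ Set.Icc (0 : ℝ) δ, f w w' :=
  continuous_parametric_integral_of_continuous hf (isCompact_box δ)

/-- Outer integrability. -/
theorem integrableOn_outer {f : ℝ × ℝ → ℝ × ℝ → ℝ} (hf : Continuous (Function.uncurry f)) (δ : ℝ) :
    IntegrableOn (fun w => ∫ w' in Set.Icc (0 : ℝ) δ ×ˢ Set.Icc (0 : ℝ) δ, f w w')
      (Set.Icc (0 : ℝ) δ ×ˢ Set.Icc (0 : ℝ) δ) :=
  (continuous_inner hf δ).continuousOn.integrableOn_compact (isCompact_box δ)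

/-- Additivity of iterated box integrals of jointly continuous functions. -/
theorem iter_add {f g : ℝ × ℝ → ℝ × ℝ → ℝ} (hf : Continuous (Function.uncurry f))
    (hg : Continuous (Function.uncurry g)) (δ : ℝ) :
    ∫ w in Set.Icc (0 : ℝ) δ ×ˢ Set.Icc (0 : ℝ) δ, ∫ w' in Set.Icc (0 : ℝ) δ ×ˢ Set.Icc (0 : ℝ) δ,
        (f w w' + g w w') =
      (∫ w in Set.Icc (0 : ℝ) δ ×ˢ Set.Icc (0 : ℝ) δ, ∫ w' in Set.Icc (0 : ℝ) δ ×ˢ Set.Icc (0 : ℝ) δ, f w w') +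
      ∫ w in Set.Icc (0 : ℝ) δ ×ˢ Set.Icc (0 : ℝ) δ, ∫ w' in Set.Icc (0 : ℝ) δ ×ˢ Set.Icc (0 : ℝ) δ, g w w' := by
  have h1 : ∀ w, ∫ w' in Set.Icc (0 : ℝ) δ ×ˢ Set.Icc (0 : ℝ) δ, (f w w' + g w w') =
      (∫ w' in Set.Icc (0 : ℝ) δ ×ˢ Set.Icc (0 : ℝ) δ, f w w') +
        ∫ w' in Set.Icc (0 : ℝ) δ ×ˢ Set.Icc (0 : ℝ) δ, g w w' :=
    fun w => integral_add (integrableOn_inner hf δ w) (integrableOn_inner hg δ w)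
  simp_rw [h1]
  exact integral_add (integrableOn_outer hf δ) (integrableOn_outer hg δ)

/-- Subtractivity of iterated box integrals of jointly continuous functions. -/
theorem iter_sub {f g : ℝ × ℝ → ℝ × ℝ → ℝ} (hf : Continuous (Function.uncurry f))
    (hg : Continuous (Function.uncurry g)) (δ : ℝ) :
    ∫ w in Set.Icc (0 : ℝ) δ ×ˢ Set.Icc (0 : ℝ) δ, ∫ w' in Set.Icc (0 : ℝ) δ ×ˢ Set.Icc (0 : ℝ) δ,
        (f w w' - g w w') =
      (∫ w in Set.Icc (0 : ℝ) δ ×ˢ Set.Icc (0 : ℝ) δ, ∫ w' in Set.Icc (0 : ℝ) δ ×ˢ Set.Icc (0 : ℝ) δ, f w w') -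
      ∫ w in Set.Icc (0 : ℝ) δ ×ˢ Set.Icc (0 : ℝ) δ, ∫ w' in Set.Icc (0 : ℝ) δ ×ˢ Set.Icc (0 : ℝ) δ, g w w' := by
  have h1 : ∀ w, ∫ w' in Set.Icc (0 : ℝ) δ ×ˢ Set.Icc (0 : ℝ) δ, (f w w' - g w w') =
      (∫ w' in Set.Icc (0 : ℝ) δ ×ˢ Set.Icc (0 : ℝ) δ, f w w') -
        ∫ w' in Set.Icc (0 : ℝ) δ ×ˢ Set.Icc (0 : ℝ) δ, g w w' :=
    fun w => integral_sub (integrableOn_inner hf δ w) (integrableOn_inner hg δ w)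
  simp_rw [h1]
  exact integral_sub (integrableOn_outer hf δ) (integrableOn_outer hg δ)

/-- Scalars come out of iterated box integrals. -/
theorem iter_const_mul (f : ℝ × ℝ → ℝ × ℝ → ℝ) (c δ : ℝ) :
    ∫ w in Set.Icc (0 : ℝ) δ ×ˢ Set.Icc (0 : ℝ) δ, ∫ w' in Set.Icc (0 : ℝ) δ ×ˢ Set.Icc (0 : ℝ) δ,
        c * f w w' =
      c * ∫ w in Set.Icc (0 : ℝ) δ ×ˢ Set.Icc (0 : ℝ) δ, ∫ w' in Set.Icc (0 : ℝ) δ ×ˢ Set.Icc (0 : ℝ) δ,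
        f w w' := by
  simp_rw [integral_const_mul]

/-! ## The chart weights on the light cone -/

/-- On the light cone the chart weights are monotone in `A - |B|`: if `A' + |B'| ≤ A - |B|` then
`e^{-(A p₀ + B p₁)} ≤ e^{-(A' p₀ + B' p₁)}` a.e. -/
theorem ae_weight_mono {μ : Measure E4} (hcone : μ {p : E4 | p 0 < |p 1|} = 0) {A B A' B' : ℝ}
    (h : A' + |B'| ≤ A - |B|) :
    ∀ᵐ p ∂μ, Real.exp (-(A * p 0 + B * p 1)) ≤ Real.exp (-(A' * p 0 + B' * p 1)) := by
  filter_upwards [measure_eq_zero_iff_ae_notMem.1 hcone] with p hp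
  simp only [not_lt] at hp
  have hp0 : 0 ≤ p 0 := (abs_nonneg _).trans hp
  apply Real.exp_le_exp.2
  have h1 : -(|B| * |p 1|) ≤ B * p 1 := by
    rw [← abs_mul]; exact neg_abs_le _
  have h2 : B' * p 1 ≤ |B'| * |p 1| := by
    rw [← abs_mul]; exact le_abs_self _
  have h3 : |B| * |p 1| ≤ |B| * p 0 := mul_le_mul_of_nonneg_left hp (abs_nonneg _)
  have h4 : |B'| * |p 1| ≤ |B'| * p 0 := mul_le_mul_of_nonneg_left hp (abs_nonneg _)
  nlinarith

/-- On the light cone the chart weights are `≤ 1` a.e. when `|B| ≤ A`. -/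
theorem ae_weight_le_one {μ : Measure E4} (hcone : μ {p : E4 | p 0 < |p 1|} = 0) {A B : ℝ}
    (h : |B| ≤ A) : ∀ᵐ p ∂μ, Real.exp (-(A * p 0 + B * p 1)) ≤ 1 := by
  filter_upwards [ae_weight_mono hcone (A' := 0) (B' := 0) (A := A) (B := B) (by simpa using h)]
    with p hp
  simpa using hp

/-- The chart integrand `exp(-(A p₀ + B p₁) + i(y p₂ + z p₃))` is continuous in `p`. -/
theorem continuous_chartIntegrand (A B y z : ℝ) :
    Continuous fun p : E4 => Complex.exp ((((-(A * p 0 + B * p 1)) : ℝ) : ℂ) +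
      ((y * p 2 + z * p 3 : ℝ) : ℂ) * Complex.I) := by
  have h : ∀ i : Fin 4, Continuous fun p : E4 => p i := fun i => PiLp.continuous_apply 2 _ i
  have h0 := h 0; have h1 := h 1; have h2 := h 2; have h3 := h 3
  fun_prop

/-- Norm of the chart integrand. -/
theorem norm_chartIntegrand (A B y z : ℝ) (p : E4) :
    ‖Complex.exp ((((-(A * p 0 + B * p 1)) : ℝ) : ℂ) + ((y * p 2 + z * p 3 : ℝ) : ℂ) * Complex.I)‖ =
      Real.exp (-(A * p 0 + B * p 1)) := by
  rw [Complex.norm_exp]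
  simp

/-- Real part of the chart integrand. -/
theorem re_chartIntegrand (A B y z : ℝ) (p : E4) :
    (Complex.exp ((((-(A * p 0 + B * p 1)) : ℝ) : ℂ) + ((y * p 2 + z * p 3 : ℝ) : ℂ) * Complex.I)).re =
      Real.exp (-(A * p 0 + B * p 1)) * Real.cos (y * p 2 + z * p 3) := by
  rw [Complex.exp_re]
  simp

/-- **Integrability of the chart integrand** against a finite measure carried by the light cone,
for `|B| ≤ A`. -/
theorem integrable_chart {μ : Measure E4} [IsFiniteMeasure μ] (hcone : μ {p : E4 | p 0 < |p 1|} = 0)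
    {A B : ℝ} (h : |B| ≤ A) (y z : ℝ) :
    Integrable (fun p : E4 => Complex.exp ((((-(A * p 0 + B * p 1)) : ℝ) : ℂ) +
      ((y * p 2 + z * p 3 : ℝ) : ℂ) * Complex.I)) μ := by
  refine Integrable.mono' (integrable_const (1 : ℝ))
    (continuous_chartIntegrand A B y z).aestronglyMeasurable ?_
  filter_upwards [ae_weight_le_one hcone h] with p hp
  rw [norm_chartIntegrand]
  exact hp

/-- **Two-point positivity.** If `P₀` and `P_ζ` are the (real) values of the chart integral at the
transverse offsets `0` and `ζ = (y,z)`, then `P₀ ± P_ζ = ∫ e^{-(A p₀ + B p₁)} (1 ± cos(y p₂ + z p₃)) dμ ≥ 0`. -/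
theorem two_point {μ : Measure E4} [IsFiniteMeasure μ] (hcone : μ {p : E4 | p 0 < |p 1|} = 0)
    {A B : ℝ} (hAB : |B| ≤ A) (y z : ℝ) {P₀ P : ℝ}
    (h0 : ((P₀ : ℝ) : ℂ) = ∫ p, Complex.exp ((((-(A * p 0 + B * p 1)) : ℝ) : ℂ) +
      ((0 * p 2 + 0 * p 3 : ℝ) : ℂ) * Complex.I) ∂μ)
    (hζ : ((P : ℝ) : ℂ) = ∫ p, Complex.exp ((((-(A * p 0 + B * p 1)) : ℝ) : ℂ) +
      ((y * p 2 + z * p 3 : ℝ) : ℂ) * Complex.I) ∂μ) :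
    0 ≤ P₀ + P ∧ 0 ≤ P₀ - P := by
  have i0 := integrable_chart hcone hAB 0 0 (μ := μ)
  have iζ := integrable_chart hcone hAB y z (μ := μ)
  -- real parts
  have r0 : P₀ = ∫ p, Real.exp (-(A * p 0 + B * p 1)) ∂μ := by
    have := congrArg Complex.re h0
    rw [Complex.ofReal_re] at this
    rw [this, ← RCLike.re_to_complex, ← integral_re i0]
    refine integral_congr_ae (ae_of_all _ fun p => ?_)
    show RCLike.re _ = _
    rw [RCLike.re_to_complex, re_chartIntegrand]
    simp
  have rζ : P = ∫ p, Real.exp (-(A * p 0 + B * p 1)) * Real.cos (y * p 2 + z * p 3) ∂μ := by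
    have := congrArg Complex.re hζ
    rw [Complex.ofReal_re] at this
    rw [this, ← RCLike.re_to_complex, ← integral_re iζ]
    refine integral_congr_ae (ae_of_all _ fun p => ?_)
    show RCLike.re _ = _
    rw [RCLike.re_to_complex, re_chartIntegrand]
  -- integrability of the real integrands
  have hm0 : Continuous fun p : E4 => Real.exp (-(A * p 0 + B * p 1)) := by
    have h : ∀ i : Fin 4, Continuous fun p : E4 => p i := fun i => PiLp.continuous_apply 2 _ i
    have h0 := h 0; have h1 := h 1
    fun_prop
  have hmζ : Continuous fun p : E4 => Real.exp (-(A * p 0 + B * p 1)) * Real.cos (y * p 2 + z * p 3) := by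
    have h : ∀ i : Fin 4, Continuous fun p : E4 => p i := fun i => PiLp.continuous_apply 2 _ i
    have h0 := h 0; have h1 := h 1; have h2 := h 2; have h3 := h 3
    fun_prop
  have j0 : Integrable (fun p : E4 => Real.exp (-(A * p 0 + B * p 1))) μ := by
    refine Integrable.mono' (integrable_const (1 : ℝ)) hm0.aestronglyMeasurable ?_
    filter_upwards [ae_weight_le_one hcone hAB] with p hp
    rw [Real.norm_eq_abs, abs_of_pos (Real.exp_pos _)]
    exact hp
  have jζ : Integrable (fun p : E4 => Real.exp (-(A * p 0 + B * p 1)) * Real.cos (y * p 2 + z * p 3)) μ := by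
    refine Integrable.mono' j0 hmζ.aestronglyMeasurable (ae_of_all _ fun p => ?_)
    rw [Real.norm_eq_abs, abs_mul, abs_of_pos (Real.exp_pos _)]
    exact mul_le_of_le_one_right (Real.exp_pos _).le (Real.abs_cos_le_one _)
  rw [r0, rζ, ← integral_add j0 jζ, ← integral_sub j0 jζ]
  constructor
  · refine integral_nonneg fun p => ?_
    have := Real.neg_one_le_cos (y * p 2 + z * p 3)
    have := Real.exp_pos (-(A * p 0 + B * p 1))
    simp only [Pi.zero_apply]
    nlinarith
  · refine integral_nonneg fun p => ?_
    have := Real.cos_le_one (y * p 2 + z * p 3)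
    have := Real.exp_pos (-(A * p 0 + B * p 1))
    simp only [Pi.zero_apply]
    nlinarith

end TransversePinch

end Summit.QuantumFields.YangMills.Cruxes.ShellRigidity.ThalesSlitExactConeType
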